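import Literature.NumberTheory.Sieve.FGKMT2018SingularSeriesConvergence
import HarnessLib

/-!
# FGKMT 2018 Thm 6 / Maynard 2016 Prop. 6.1: the clause `𝔖_B(𝓛) ≥ e^{−Kk}` — explicit lower
bounds for the singular series of an admissible non-degenerate family

Source: J. Maynard, *Dense clusters of primes in subsets*, Compositio Math. 152 (2016),
Proposition 6.1 («`𝔖_B(𝓛) ≫ 1/exp(O(k))`») and Lemma 8.1 p. 15 [Maynard2016DenseClusters];
K. Ford, B. Green, S. Konyagin, J. Maynard, T. Tao, *Long gaps between primes*, J. Amer. Math.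
Soc. 31 (2018), Theorem 6 and §8 (6.2) («`𝔖(𝓛_p) ≥ e^{−Ck}`») [FordGreenKonyaginMaynardTao2018].

Continuation of `FGKMT2018SingularSeriesConvergence` (existence and positivity of
`𝔖_D(𝓛) = singSeriesExcl L D` for admissible non-degenerate `𝓛`). Here the lower bound is made
EXPLICIT and uniform in the family, which is the first conclusion
`Real.exp (-(K * k)) ≤ singSeriesExcl L B` of the named facts
`FordGreenKonyaginMaynardTao2018_theorem6ZN` / `Maynard2016DenseClusters_prop61Z` (with `K = 7`):

* `omegaL_le_card_of_admissible`: `ω_𝓛(p) ≤ k` for admissible `𝓛` and prime `p`;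
* `inv_le_singFactor_of_admissible`: every Euler factor is `≥ 1/p`;
  `one_sub_le_singFactor_of_omegaL_le`: `≥ 1 − k²/p²` once `ω(p) ≤ k ≤ p`;
* `inv_primorial_le_singPartial`: `𝔖_D(𝓛; x) ≥ 1/x#`;
  `singPartial_mul_exp_le_singPartial_add`: past `P₀ ≥ max(1, 2k)` the partial products lose at
  most a factor `exp(−2k²(1/P₀ − 1/(P₀+m)))` (no hypothesis on the exceptional primes);
* `inv_primorial_mul_exp_le_singSeriesExcl`: `𝔖_D(𝓛) ≥ e^{−k}/(2k+1)#`;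
  `exp_neg_seven_mul_le_singSeriesExcl`: **`𝔖_D(𝓛) ≥ e^{−7k}`** for `k ≥ 1`
  (`(2k+1)# ≤ 4^{2k+1} ≤ 64^k ≤ e^{6k}`, `primorial_le_four_pow`).

## References
* [Maynard2016DenseClusters] Prop. 6.1 p. 9, Lemma 8.1 p. 15.
* [FordGreenKonyaginMaynardTao2018] Thm 6 pp. 21–22, §8 (6.2) p. 22.
-/

noncomputable section

open Finset Filter Topology

namespace Literature.NumberTheory.Sieve.FGKMT2018

variable {k : ℕ}

/-- `e^{−2t} ≤ 1 − t` for `0 ≤ t ≤ 1/2` (from `1 + 2t ≤ e^{2t}`). [folklore] -/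
private theorem exp_neg_two_mul_le' {t : ℝ} (h0 : 0 ≤ t) (h1 : t ≤ 1 / 2) :
    Real.exp (-(2 * t)) ≤ 1 - t := by
  have h2 : 1 + 2 * t ≤ Real.exp (2 * t) := by linarith [Real.add_one_le_exp (2 * t)]
  have hpos : (0 : ℝ) < 1 + 2 * t := by linarith
  rw [Real.exp_neg]
  calc (Real.exp (2 * t))⁻¹ ≤ (1 + 2 * t)⁻¹ := by
        rw [inv_le_inv₀ (Real.exp_pos _) hpos]; exact h2
    _ ≤ 1 - t := by
        rw [inv_le_iff_one_le_mul₀ hpos]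
        nlinarith

/-! ### `ω_𝓛(p) ≤ k` and the crude factor bound `1/p ≤ (1 − ω(p)/p)(1 − 1/p)^{-k}` -/

/-- **`ω_𝓛(p) ≤ k`** for an admissible family and a prime `p`: each form has at most one root
mod `p` (a form vanishing identically mod `p` would give `ω(p) = p`, excluded by admissibility).
[cite: Maynard2016DenseClusters, §7 p. 13] -/
theorem omegaL_le_card_of_admissible {L : Fin k → ℤ × ℤ} (hadm : FormsAdmissible L) {p : ℕ}
    (hp : p.Prime) : omegaL L p ≤ k := by
  classical
  haveI := Fact.mk hp
  have hlt := ((formsAdmissible_iff_omegaL L).mp hadm).2 p hp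
  rw [omegaL_eq_card_zmod] at hlt ⊢
  set r : Fin k → ZMod p := fun i => -(((L i).2 : ℤ) : ZMod p) / (((L i).1 : ℤ) : ZMod p) with hr
  have hsub : (Finset.univ.filter fun x : ZMod p => ∏ i, formMod (L i) p x = 0)
      ⊆ Finset.univ.image r := by
    intro x hx
    simp only [Finset.mem_filter, Finset.mem_univ, true_and, Finset.prod_eq_zero_iff, formMod] at hx
    obtain ⟨i, hi⟩ := hx
    by_cases hai : (((L i).1 : ℤ) : ZMod p) = 0
    · exfalso
      have hbi : (((L i).2 : ℤ) : ZMod p) = 0 := by simpa [hai] using hi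
      have hall : (Finset.univ.filter fun x : ZMod p => ∏ i, formMod (L i) p x = 0) = Finset.univ := by
        refine Finset.eq_univ_of_forall fun y => ?_
        simp only [Finset.mem_filter, Finset.mem_univ, true_and, Finset.prod_eq_zero_iff, formMod]
        exact ⟨i, by rw [hai, hbi]; ring⟩
      rw [hall, Finset.card_univ, ZMod.card] at hlt
      exact lt_irrefl _ hlt
    · rw [Finset.mem_image]
      refine ⟨i, Finset.mem_univ _, ?_⟩
      have h3 : (((L i).1 : ℤ) : ZMod p) * x = -(((L i).2 : ℤ) : ZMod p) :=
        eq_neg_of_add_eq_zero_left hi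
      rw [hr]
      exact ((eq_div_iff hai).mpr (by rw [mul_comm]; exact h3)).symm
  calc #(Finset.univ.filter fun x : ZMod p => ∏ i, formMod (L i) p x = 0)
      ≤ #(Finset.univ.image r) := Finset.card_le_card hsub
    _ ≤ #(Finset.univ : Finset (Fin k)) := Finset.card_image_le
    _ = k := by rw [Finset.card_univ, Fintype.card_fin]

/-- **Crude lower bound for every Euler factor**: for an admissible family and a prime `p`,
`1/p ≤ (1 − ω(p)/p)(1 − 1/p)^{-k}` (as `ω(p) ≤ p − 1` and `(1 − 1/p)^{-k} ≥ 1`).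
[cite: Maynard2016DenseClusters, Lemma 8.1 p. 15] -/
theorem inv_le_singFactor_of_admissible {L : Fin k → ℤ × ℤ} (hadm : FormsAdmissible L) {p : ℕ}
    (hp : p.Prime) : (p : ℝ)⁻¹ ≤ singFactor L p := by
  unfold singFactor
  have hω := ((formsAdmissible_iff_omegaL L).mp hadm).2 p hp
  have hp0 : (0 : ℝ) < p := by exact_mod_cast hp.pos
  have hq : 0 < 1 - 1 / (p : ℝ) := by
    rw [sub_pos, div_lt_one hp0]; exact_mod_cast hp.one_lt
  have hq1 : 1 - 1 / (p : ℝ) ≤ 1 := by linarith [show (0 : ℝ) ≤ 1 / (p : ℝ) from by positivity]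
  have h1 : (p : ℝ)⁻¹ ≤ 1 - (omegaL L p : ℝ) / p := by
    have hle : (omegaL L p : ℝ) + 1 ≤ p := by exact_mod_cast hω
    rw [inv_eq_one_div, le_sub_iff_add_le, ← add_div, div_le_one hp0]
    linarith
  have h2 : (1 : ℝ) ≤ (1 - 1 / (p : ℝ))⁻¹ ^ k := one_le_pow₀ ((one_le_inv₀ hq).mpr hq1)
  calc (p : ℝ)⁻¹ = (p : ℝ)⁻¹ * 1 := (mul_one _).symm
    _ ≤ (1 - (omegaL L p : ℝ) / p) * (1 - 1 / (p : ℝ))⁻¹ ^ k :=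
        mul_le_mul h1 h2 zero_le_one ((inv_pos.mpr hp0).le.trans h1)

/-- **Lower bound** `1 − k²/p² ≤ (1 − ω(p)/p)(1 − 1/p)^{-k}` whenever `ω(p) ≤ k ≤ p`, `p ≥ 2`
(in particular for every prime `p ≥ k` of an admissible family).
[cite: Maynard2016DenseClusters, Lemma 8.1 p. 15] -/
theorem one_sub_le_singFactor_of_omegaL_le (L : Fin k → ℤ × ℤ) {p : ℕ} (hp : 2 ≤ p)
    (hkp : k ≤ p) (hω : omegaL L p ≤ k) :
    1 - (k : ℝ) ^ 2 / (p : ℝ) ^ 2 ≤ singFactor L p := by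
  unfold singFactor
  have hp0 : (0 : ℝ) < p := by exact_mod_cast (by omega : 0 < p)
  have hq : 0 < 1 - 1 / (p : ℝ) := by
    rw [sub_pos, div_lt_one hp0]; exact_mod_cast (by omega : 1 < p)
  have h0 : 1 - (k : ℝ) / p ≤ 1 - (omegaL L p : ℝ) / p := by
    have : (omegaL L p : ℝ) ≤ k := by exact_mod_cast hω
    have := div_le_div_of_nonneg_right this hp0.le
    linarith
  have h1 : 0 ≤ 1 - (k : ℝ) / p := by
    rw [sub_nonneg, div_le_one hp0]; exact_mod_cast hkp
  have h3 : 1 + 1 / (p : ℝ) ≤ (1 - 1 / (p : ℝ))⁻¹ := by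
    rw [← one_div, le_div_iff₀ hq]
    have e : (1 + 1 / (p : ℝ)) * (1 - 1 / p) = 1 - 1 / (p : ℝ) ^ 2 := by ring
    rw [e]
    have : (0 : ℝ) ≤ 1 / (p : ℝ) ^ 2 := by positivity
    linarith
  have h2 : 1 + (k : ℝ) / p ≤ (1 - 1 / (p : ℝ))⁻¹ ^ k :=
    calc 1 + (k : ℝ) / p = 1 + k * (1 / (p : ℝ)) := by ring
      _ ≤ (1 + 1 / (p : ℝ)) ^ k :=
          one_add_mul_le_pow (by linarith [show (0 : ℝ) ≤ 1 / (p : ℝ) from by positivity]) k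
      _ ≤ (1 - 1 / (p : ℝ))⁻¹ ^ k := by gcongr
  calc 1 - (k : ℝ) ^ 2 / (p : ℝ) ^ 2 = (1 - k / p) * (1 + k / p) := by ring
    _ ≤ (1 - (k : ℝ) / p) * (1 - 1 / (p : ℝ))⁻¹ ^ k := mul_le_mul_of_nonneg_left h2 h1
    _ ≤ (1 - (omegaL L p : ℝ) / p) * (1 - 1 / (p : ℝ))⁻¹ ^ k :=
        mul_le_mul_of_nonneg_right h0 (pow_nonneg (inv_pos.mpr hq).le _)

/-! ### Explicit lower bounds: `𝔖_D(𝓛; x) ≥ 1/x#` and `𝔖_D(𝓛) ≥ e^{−k}/(2k+1)# ≥ e^{−7k}` -/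

/-- `(x+1)# = x# · (x+1 if prime, else 1)`. [folklore] -/
private theorem primorial_succ' (x : ℕ) :
    primorial (x + 1) = primorial x * (if (x + 1).Prime then x + 1 else 1) := by
  unfold primorial
  rw [Finset.prod_filter, Finset.prod_filter, Finset.prod_range_succ]

/-- **`𝔖_D(𝓛; x) ≥ 1/x#`** (primorial) for an admissible family: every Euler factor is `≥ 1/p`.
[cite: Maynard2016DenseClusters, Lemma 8.1 p. 15] -/
theorem inv_primorial_le_singPartial {L : Fin k → ℤ × ℤ} (hadm : FormsAdmissible L) (D x : ℕ) :
    ((primorial x : ℕ) : ℝ)⁻¹ ≤ singPartial L D x := by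
  induction x with
  | zero =>
    have h0 : singPartial L D 0 = 1 := by
      unfold singPartial
      refine Finset.prod_eq_one fun p hp => ?_
      rw [Finset.mem_filter, Finset.mem_range] at hp
      have hp0 : p = 0 := by omega
      exact absurd (hp0 ▸ hp.2.1) Nat.not_prime_zero
    rw [h0, primorial_zero]; simp
  | succ x ih =>
    rw [singPartial_succ, primorial_succ']
    have hS := (singPartial_pos_of_admissible hadm D x).le
    by_cases hpr : (x + 1).Prime
    · rw [if_pos hpr]
      push_cast
      rw [mul_inv]
      refine mul_le_mul ih ?_ (by positivity) hS
      split_ifs with hc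
      · have := inv_le_singFactor_of_admissible hadm hpr (L := L)
        push_cast at this
        exact this
      · exact inv_le_one_of_one_le₀ (by exact_mod_cast Nat.le_add_left 1 x)
    · rw [if_neg hpr, if_neg (fun h => hpr h.1), mul_one, mul_one]
      exact ih

/-- **Lower tail control** (no hypothesis on the exceptional primes): for an admissible family and
`P₀ ≥ max(1, 2k)`, `𝔖_D(𝓛; P₀) · exp(−2k²(1/P₀ − 1/(P₀+m))) ≤ 𝔖_D(𝓛; P₀ + m)` — every factor at
a prime `p > 2k` is `≥ 1 − k²/p² ≥ e^{−2k²/p²}` because `ω(p) ≤ k`.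
[cite: Maynard2016DenseClusters, Lemma 8.1 p. 15] -/
theorem singPartial_mul_exp_le_singPartial_add {L : Fin k → ℤ × ℤ} (hadm : FormsAdmissible L)
    {P₀ : ℕ} (hP1 : 1 ≤ P₀) (hPk : 2 * k ≤ P₀) (D m : ℕ) :
    singPartial L D P₀ * Real.exp (-(2 * (k : ℝ) ^ 2 * (1 / (P₀ : ℝ) - 1 / ((P₀ + m : ℕ) : ℝ))))
      ≤ singPartial L D (P₀ + m) := by
  induction m with
  | zero => simp
  | succ m ih =>
    set n : ℕ := P₀ + m with hn
    have hPm : P₀ + (m + 1) = n + 1 := by rw [hn, Nat.add_assoc]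
    rw [hPm, singPartial_succ]
    have hn1 : 1 ≤ n := le_trans hP1 (Nat.le_add_right _ _)
    have hnR : (1 : ℝ) ≤ n := by exact_mod_cast hn1
    have hcast : ((n + 1 : ℕ) : ℝ) = (n : ℝ) + 1 := by push_cast; ring
    have hSn : 0 ≤ singPartial L D n := (singPartial_pos_of_admissible hadm D n).le
    have hdiff : 0 ≤ 1 / (n : ℝ) - 1 / ((n : ℝ) + 1) := by
      rw [sub_nonneg]
      exact one_div_le_one_div_of_le (by linarith) (by linarith)
    have hc_ge : Real.exp (-(2 * (k : ℝ) ^ 2 * (1 / (n : ℝ) - 1 / ((n : ℝ) + 1))))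
        ≤ (if (n + 1).Prime ∧ ¬ (n + 1) ∣ D then singFactor L (n + 1) else 1) := by
      split_ifs with hc
      · have hω := omegaL_le_card_of_admissible hadm hc.1
        have hb := one_sub_le_singFactor_of_omegaL_le L (by omega : 2 ≤ n + 1)
          (by omega : k ≤ n + 1) hω
        rw [hcast] at hb
        refine le_trans ?_ hb
        have ht0 : (0 : ℝ) ≤ (k : ℝ) ^ 2 / ((n : ℝ) + 1) ^ 2 := by positivity
        have h2k : (2 * k : ℝ) ≤ (n : ℝ) + 1 := by exact_mod_cast (by omega : 2 * k ≤ n + 1)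
        have ht1 : (k : ℝ) ^ 2 / ((n : ℝ) + 1) ^ 2 ≤ 1 / 2 := by
          rw [div_le_iff₀ (by positivity)]
          nlinarith [sq_nonneg (k : ℝ)]
        refine le_trans (Real.exp_le_exp.mpr ?_) (exp_neg_two_mul_le' ht0 ht1)
        have key : 1 / ((n : ℝ) + 1) ^ 2 ≤ 1 / (n : ℝ) - 1 / ((n : ℝ) + 1) := by
          rw [div_sub_div _ _ (by positivity) (by positivity),
            div_le_div_iff₀ (by positivity) (by positivity)]
          nlinarith
        have := mul_le_mul_of_nonneg_left key (by positivity : (0 : ℝ) ≤ 2 * (k : ℝ) ^ 2)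
        have e1 : 2 * ((k : ℝ) ^ 2 / ((n : ℝ) + 1) ^ 2)
            = 2 * (k : ℝ) ^ 2 * (1 / ((n : ℝ) + 1) ^ 2) := by ring
        linarith
      · exact Real.exp_le_one_iff.mpr (neg_nonpos.mpr (mul_nonneg (by positivity) hdiff))
    have hsplit : Real.exp (-(2 * (k : ℝ) ^ 2 * (1 / (P₀ : ℝ) - 1 / ((n + 1 : ℕ) : ℝ))))
        = Real.exp (-(2 * (k : ℝ) ^ 2 * (1 / (P₀ : ℝ) - 1 / ((n : ℕ) : ℝ))))
          * Real.exp (-(2 * (k : ℝ) ^ 2 * (1 / (n : ℝ) - 1 / ((n : ℝ) + 1)))) := by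
      rw [← Real.exp_add, hcast]; ring_nf
    rw [hsplit, ← mul_assoc]
    exact le_trans (mul_le_mul_of_nonneg_right ih (Real.exp_pos _).le)
      (mul_le_mul_of_nonneg_left hc_ge hSn)

/-- **`𝔖_D(𝓛) ≥ e^{−k}/(2k+1)#`** for admissible non-degenerate families (all `D`): the factors at
`p ≤ 2k+1` contribute `≥ 1/(2k+1)#`, those at `p > 2k+1` contribute `≥ exp(−2k²/(2k+1)) ≥ e^{−k}`.
[cite: Maynard2016DenseClusters, Prop. 6.1 («𝔖_B(𝓛) ≫ exp(−O(k))»), Lemma 8.1 p. 15] -/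
theorem inv_primorial_mul_exp_le_singSeriesExcl {L : Fin k → ℤ × ℤ} (hadm : FormsAdmissible L)
    (hnd : FormsNondegenerate L) (D : ℕ) :
    ((primorial (2 * k + 1) : ℕ) : ℝ)⁻¹ * Real.exp (-(k : ℝ)) ≤ singSeriesExcl L D := by
  have hlim := tendsto_singPartial_of_nondegenerate hadm hnd D
  refine ge_of_tendsto hlim (Filter.eventually_atTop.mpr ⟨2 * k + 1, fun x hx => ?_⟩)
  obtain ⟨m, rfl⟩ := Nat.exists_eq_add_of_le hx
  refine le_trans ?_ (singPartial_mul_exp_le_singPartial_add hadm (P₀ := 2 * k + 1)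
    (by omega) (by omega) D m)
  refine mul_le_mul (inv_primorial_le_singPartial hadm D _) (Real.exp_le_exp.mpr ?_)
    (Real.exp_pos _).le (singPartial_pos_of_admissible hadm D _).le
  have hA : (0 : ℝ) ≤ 1 / ((2 * k + 1 + m : ℕ) : ℝ) := by positivity
  have hB : 2 * (k : ℝ) ^ 2 * (1 / ((2 * k + 1 : ℕ) : ℝ)) ≤ k := by
    push_cast
    rw [mul_one_div, div_le_iff₀ (by positivity)]
    nlinarith [sq_nonneg (k : ℝ), (Nat.cast_nonneg k : (0 : ℝ) ≤ k)]
  nlinarith [mul_nonneg (by positivity : (0 : ℝ) ≤ 2 * (k : ℝ) ^ 2) hA]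

/-- **`𝔖_D(𝓛) ≥ e^{−7k}`** for admissible non-degenerate families with `k ≥ 1` and every `D`
(from `(2k+1)# ≤ 4^{2k+1} ≤ 64^k ≤ e^{6k}`): the `𝔖(𝓛) ≥ e^{−Kk}` clause of
[FordGreenKonyaginMaynardTao2018, Thm 6] / [Maynard2016DenseClusters, Prop. 6.1] with `K = 7`.
[cite: Maynard2016DenseClusters, Prop. 6.1 («𝔖_B(𝓛) ≫ exp(−O(k))»); FordGreenKonyaginMaynardTao2018, §8 (6.2)] -/
theorem exp_neg_seven_mul_le_singSeriesExcl {L : Fin k → ℤ × ℤ} (hadm : FormsAdmissible L)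
    (hnd : FormsNondegenerate L) (hk : 1 ≤ k) (D : ℕ) :
    Real.exp (-(7 * (k : ℝ))) ≤ singSeriesExcl L D := by
  refine le_trans ?_ (inv_primorial_mul_exp_le_singSeriesExcl hadm hnd D)
  have h4 : ((primorial (2 * k + 1) : ℕ) : ℝ) ≤ Real.exp (6 * k) := by
    have h1 : ((primorial (2 * k + 1) : ℕ) : ℝ) ≤ (4 : ℝ) ^ (2 * k + 1) := by
      exact_mod_cast primorial_le_four_pow (2 * k + 1)
    have h2 : (4 : ℝ) ^ (2 * k + 1) ≤ 4 ^ (3 * k) := pow_le_pow_right₀ (by norm_num) (by omega)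
    have h3 : (4 : ℝ) ^ (3 * k) = (64 : ℝ) ^ k := by rw [pow_mul]; norm_num
    have he : (64 : ℝ) ≤ Real.exp 6 := by
      have h2e : (2 : ℝ) ≤ Real.exp 1 := by linarith [Real.add_one_le_exp (1 : ℝ)]
      calc (64 : ℝ) = 2 ^ 6 := by norm_num
        _ ≤ (Real.exp 1) ^ 6 := by gcongr
        _ = Real.exp 6 := by rw [Real.exp_one_pow]; norm_num
    calc ((primorial (2 * k + 1) : ℕ) : ℝ) ≤ (4 : ℝ) ^ (2 * k + 1) := h1
      _ ≤ 4 ^ (3 * k) := h2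
      _ = (64 : ℝ) ^ k := h3
      _ ≤ (Real.exp 6) ^ k := by gcongr
      _ = Real.exp (6 * k) := by rw [← Real.exp_nat_mul]; ring_nf
  have e7 : Real.exp (-(7 * (k : ℝ))) = Real.exp (-(6 * (k : ℝ))) * Real.exp (-(k : ℝ)) := by
    rw [← Real.exp_add]; ring_nf
  rw [e7]
  refine mul_le_mul_of_nonneg_right ?_ (Real.exp_pos _).le
  rw [Real.exp_neg, inv_le_inv₀ (Real.exp_pos _) (by exact_mod_cast primorial_pos _)]
  exact h4

end Literature.NumberTheory.Sieve.FGKMT2018
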